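import Literature.NumberTheory.LFunctions.PartialEulerProductsPrimeSums
import Mathlib.Analysis.Normed.Group.Tannery
import HarnessLib

/-!
# The Dirichlet series of Mertens' logarithms: `∑_p -log(1 - 1/p) p^{-u} = -log u + o(1)`

Topic `Literature/NumberTheory/LFunctions` (trunk T-ANT). An input for the printed form of
K. Conrad's Theorem 5.3 (*Partial Euler products on the critical line*, Canad. J. Math. **57**
(2005), p. 279: the constant `e^{rγ}` of (5.2) comes from Lemma 5.1,
`s ∫_e^∞ (log log x) x^{-s-1} dx = -log s - γ + o(1)`); in the discrete approach of this library
the role of `log log x` is played by Mertens' `A(x) = ∑_{p ≤ x} -log(1 - 1/p) = log log x + γ + o(1)`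
(`Literature.NumberTheory.LFunctions.Mertens.tendsto_mertensLog_sub_loglog`), whose Dirichlet series is computed here:

* `tendsto_tsum_neg_log_one_sub_inv_mul_rpow_add_log`:
  `∑_p -log(1 - 1/p) p^{-u} + log u → 0` as `u → 0⁺`.

Proof: `∑_p -log(1 - p^{-1-u}) = log ζ(1+u) = -log u + log (u ζ(1+u))` with `u ζ(1+u) → 1`
(`Literature.NumberTheory.LFunctions.Nicolas.zetaOne`, `PartialEulerProductsPrimeSums.tsum_neg_log_one_sub_primes_rpow_eq`), and
the difference `∑_p [(-log(1 - 1/p)) p^{-u} - (-log(1 - p^{-1-u}))]` tends to `0` by dominated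
convergence (termwise `→ 0`, dominated by `4/p²`, since `(1/p) p^{-u} = p^{-1-u}` exactly and both
logarithms differ from their linear terms by at most `2 (1/p)²`). No definitions are introduced.
[folklore]

## References

* K. Conrad, *Partial Euler products on the critical line*, Canad. J. Math. 57 (2005) 267–297,
  Lemma 5.1 and proof of Thm. 5.3. [cite: Conrad2005PartialEuler]
-/

noncomputable section

open scoped Topology
open Filter Finset Complex Literature.NumberTheory.LFunctions.Nicolas

namespace Literature.NumberTheory.LFunctions

namespace PartialEuler

/-- Termwise bound: for a prime `p` and `0 ≤ u ≤ 1`,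
`|(-log(1 - 1/p)) p^{-u} - (-log(1 - p^{-(1+u)}))| ≤ 4 / p²`. [folklore] -/
theorem abs_neg_log_mul_rpow_sub_le (p : Nat.Primes) {u : ℝ} (hu0 : 0 ≤ u) :
    |(-Real.log (1 - ((p : ℕ) : ℝ)⁻¹)) * ((p : ℕ) : ℝ) ^ (-u) -
        (-Real.log (1 - ((p : ℕ) : ℝ) ^ (-(1 + u))))| ≤ 4 / ((p : ℕ) : ℝ) ^ 2 := by
  have hp2 : (2 : ℝ) ≤ (p : ℕ) := by exact_mod_cast p.2.two_le
  have hp0 : (0 : ℝ) < (p : ℕ) := by linarith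
  set x : ℝ := ((p : ℕ) : ℝ)⁻¹ with hx
  set q : ℝ := ((p : ℕ) : ℝ) ^ (-u) with hq
  have hx0 : 0 ≤ x := by positivity
  have hxh : x ≤ 1 / 2 := by
    rw [hx, inv_le_comm₀ hp0 (by norm_num)]; linarith
  have hq0 : 0 ≤ q := by positivity
  have hq1 : q ≤ 1 := Real.rpow_le_one_of_one_le_of_nonpos (by linarith) (neg_nonpos.mpr hu0)
  -- `p^{-(1+u)} = x q`
  have hy : ((p : ℕ) : ℝ) ^ (-(1 + u)) = x * q := by
    rw [hx, hq, neg_add, Real.rpow_add hp0, Real.rpow_neg_one]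
  have hy0 : 0 ≤ x * q := by positivity
  have hyh : x * q ≤ 1 / 2 := by nlinarith
  rw [hy]
  have h1 := abs_neg_log_one_sub_sub_le hx0 hxh
  have h2 := abs_neg_log_one_sub_sub_le hy0 hyh
  -- the linear terms cancel: `x q - x q = 0`
  have key : (-Real.log (1 - x)) * q - -Real.log (1 - x * q) =
      ((-Real.log (1 - x) - x) * q) - (-Real.log (1 - x * q) - x * q) := by ring
  rw [key]
  refine (abs_sub _ _).trans ?_
  rw [abs_mul, abs_of_nonneg hq0]
  have hx2 : x ^ 2 = 1 / ((p : ℕ) : ℝ) ^ 2 := by rw [hx, inv_pow, one_div]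
  calc |-Real.log (1 - x) - x| * q + |-Real.log (1 - x * q) - x * q|
      ≤ 2 * x ^ 2 * 1 + 2 * (x * q) ^ 2 :=
        add_le_add (mul_le_mul h1 hq1 hq0 (by positivity)) h2
    _ ≤ 2 * x ^ 2 + 2 * x ^ 2 := by nlinarith [sq_nonneg x, mul_le_one₀ hq1 hq0 hq1]
    _ = 4 / ((p : ℕ) : ℝ) ^ 2 := by rw [hx2]; ring

/-- **`∑_p -log(1 - 1/p) p^{-u} + log u → 0` as `u → 0⁺`** (the Dirichlet series of Mertens'
logarithms has the singularity `-log u` at `0`, with constant `0`). [folklore] -/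
theorem tendsto_tsum_neg_log_one_sub_inv_mul_rpow_add_log :
    Tendsto (fun u : ℝ => ∑' p : Nat.Primes, (-Real.log (1 - ((p : ℕ) : ℝ)⁻¹)) * ((p : ℕ) : ℝ) ^ (-u) +
      Real.log u) (𝓝[>] 0) (𝓝 0) := by
  -- (1) the difference tends to `0` by dominated convergence
  have hdiff : Tendsto (fun u : ℝ => ∑' p : Nat.Primes,
      ((-Real.log (1 - ((p : ℕ) : ℝ)⁻¹)) * ((p : ℕ) : ℝ) ^ (-u) -
        (-Real.log (1 - ((p : ℕ) : ℝ) ^ (-(1 + u)))))) (𝓝[>] 0) (𝓝 0) := by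
    have hbound : Summable fun p : Nat.Primes => 4 / ((p : ℕ) : ℝ) ^ 2 := by
      have := (Nat.Primes.summable_rpow.mpr (by norm_num : (-2 : ℝ) < -1)).mul_left 4
      refine this.congr fun p => ?_
      rw [Real.rpow_neg (Nat.cast_nonneg _), Real.rpow_two, div_eq_mul_inv]
    have key : Tendsto (fun u : ℝ => ∑' p : Nat.Primes,
        ((-Real.log (1 - ((p : ℕ) : ℝ)⁻¹)) * ((p : ℕ) : ℝ) ^ (-u) -
          (-Real.log (1 - ((p : ℕ) : ℝ) ^ (-(1 + u)))))) (𝓝[>] 0) (𝓝 (∑' _ : Nat.Primes, (0 : ℝ))) := by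
      refine tendsto_tsum_of_dominated_convergence hbound (fun p => ?_) ?_
      · -- termwise limit `(-log(1-1/p)) · 1 - (-log(1 - 1/p)) = 0`
        have hp0 : (0 : ℝ) < (p : ℕ) := by exact_mod_cast p.2.pos
        have hc1 : Tendsto (fun u : ℝ => ((p : ℕ) : ℝ) ^ (-u)) (𝓝[>] 0) (𝓝 1) := by
          have hc : Continuous (fun u : ℝ => ((p : ℕ) : ℝ) ^ (-u)) :=
            (Real.continuous_const_rpow hp0.ne').comp continuous_neg
          have := hc.tendsto 0
          simp only [neg_zero, Real.rpow_zero] at this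
          exact this.mono_left nhdsWithin_le_nhds
        have hc2 : Tendsto (fun u : ℝ => -Real.log (1 - ((p : ℕ) : ℝ) ^ (-(1 + u)))) (𝓝[>] 0)
            (𝓝 (-Real.log (1 - ((p : ℕ) : ℝ)⁻¹))) := by
          have hc : Continuous (fun u : ℝ => ((p : ℕ) : ℝ) ^ (-(1 + u))) :=
            (Real.continuous_const_rpow hp0.ne').comp (continuous_const.add continuous_id).neg
          have h1 : Tendsto (fun u : ℝ => ((p : ℕ) : ℝ) ^ (-(1 + u))) (𝓝 0) (𝓝 (((p : ℕ) : ℝ)⁻¹)) := by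
            have := hc.tendsto 0
            simp only [add_zero, Real.rpow_neg_one] at this
            exact this
          have hne : 1 - ((p : ℕ) : ℝ)⁻¹ ≠ 0 := by
            have : ((p : ℕ) : ℝ)⁻¹ < 1 := inv_lt_one_of_one_lt₀ (by exact_mod_cast p.2.one_lt)
            linarith
          exact (((tendsto_const_nhds.sub h1).log hne).neg).mono_left nhdsWithin_le_nhds
        have := (hc1.const_mul (-Real.log (1 - ((p : ℕ) : ℝ)⁻¹))).sub hc2
        simpa using this
      · filter_upwards [Ioo_mem_nhdsGT (zero_lt_one' ℝ)] with u hu p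
        rw [Real.norm_eq_abs]
        exact abs_neg_log_mul_rpow_sub_le p hu.1.le
    rwa [tsum_zero] at key
  -- (2) `∑_p -log(1 - p^{-(1+u)}) + log u = log (zetaOne u).re → 0`
  have hzeta : Tendsto (fun u : ℝ => ∑' p : Nat.Primes, -Real.log (1 - ((p : ℕ) : ℝ) ^ (-(1 + u))) +
      Real.log u) (𝓝[>] 0) (𝓝 0) := by
    have hcont : Tendsto (fun u : ℝ => Real.log (zetaOne u).re) (𝓝[>] 0) (𝓝 0) := by
      have hc : Continuous (fun u : ℝ => (zetaOne u).re) :=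
        continuous_re.comp (continuous_zetaOne.comp continuous_ofReal)
      have h1 : Tendsto (fun u : ℝ => (zetaOne u).re) (𝓝 0) (𝓝 1) := by
        have := hc.tendsto 0
        simpa using this
      have := (h1.log one_ne_zero)
      rw [Real.log_one] at this
      exact this.mono_left nhdsWithin_le_nhds
    refine hcont.congr' ?_
    filter_upwards [self_mem_nhdsWithin] with u hu
    rw [tsum_neg_log_one_sub_primes_rpow_eq (Set.mem_Ioi.mp hu)]
    ring
  -- combine
  have := hdiff.add hzeta
  simp only [add_zero] at this
  refine this.congr' ?_
  filter_upwards [Ioo_mem_nhdsGT (zero_lt_one' ℝ)] with u hu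
  have hs1 : Summable fun p : Nat.Primes => (-Real.log (1 - ((p : ℕ) : ℝ)⁻¹)) * ((p : ℕ) : ℝ) ^ (-u) -
      (-Real.log (1 - ((p : ℕ) : ℝ) ^ (-(1 + u)))) := by
    refine Summable.of_norm_bounded ((Nat.Primes.summable_rpow.mpr (by norm_num : (-2 : ℝ) < -1)).mul_left 4)
      fun p => ?_
    rw [Real.norm_eq_abs]
    refine (abs_neg_log_mul_rpow_sub_le p hu.1.le).trans (le_of_eq ?_)
    rw [Real.rpow_neg (Nat.cast_nonneg _), Real.rpow_two, div_eq_mul_inv]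
  have hs2 : Summable fun p : Nat.Primes => -Real.log (1 - ((p : ℕ) : ℝ) ^ (-(1 + u))) := by
    -- from `PartialEulerProductsPrimeSums`: both `∑ p^{-x}` and the log-difference converge
    have hx : 1 < 1 + u := by linarith [hu.1]
    have h1 := summable_primes_rpow_neg hx
    have h3 : Summable fun p : Nat.Primes =>
        ((p : ℕ) : ℝ) ^ (-(1 + u)) - -Real.log (1 - ((p : ℕ) : ℝ) ^ (-(1 + u))) := by
      refine Summable.of_norm_bounded ((Nat.Primes.summable_rpow.mpr (by norm_num : (-2 : ℝ) < -1)).mul_left 2)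
        fun p => ?_
      rw [Real.norm_eq_abs]
      have hy0 : 0 ≤ ((p : ℕ) : ℝ) ^ (-(1 + u)) := by positivity
      have hy := primes_rpow_neg_le_half p hx.le
      have h := abs_neg_log_one_sub_sub_le hy0 hy
      rw [abs_sub_comm] at h
      refine h.trans ?_
      have hp0 : (0 : ℝ) < (p : ℕ) := by exact_mod_cast p.2.pos
      have : (((p : ℕ) : ℝ) ^ (-(1 + u))) ^ 2 ≤ ((p : ℕ) : ℝ) ^ (-2 : ℝ) := by
        rw [← Real.rpow_natCast, ← Real.rpow_mul hp0.le]
        exact Real.rpow_le_rpow_of_exponent_le (by exact_mod_cast p.2.one_lt.le) (by push_cast; linarith [hu.1])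
      linarith
    have := h1.sub h3
    simpa using this
  rw [← add_assoc, ← hs1.tsum_add hs2]
  congr 1
  refine tsum_congr fun p => ?_
  ring

end PartialEuler

end Literature.NumberTheory.LFunctions

end
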